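import Summits.BirchSwinnertonDyer.BirchSwinnertonDyer.Theses.CMKolyvaginAtInertTwo
import Literature.NumberTheory.EllipticCurves.KrizLi2019.SexticTwistAnalyticRank
import Literature.NumberTheory.EllipticCurves.AnalyticRankOrderProofs
import Literature.NumberTheory.EllipticCurves.QuadraticTwist
import HarnessLib

/-!
# Route `CMKolyvaginAtInertTwo`, crux HL′ `CMSilentHeegnerTwinSupplyAtInertTwo` (stmt-BirchSwinnertonDyer-28663) —
# THE KRIZ–LI SEXTIC DOOR (print level): on the slice `W ≅ E_d : y² = x³ − 432d` (`d < 0` fundamental, `d ≡ 2 (mod 9)`,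
# `h₃(d) = 1`), HL′(W) ⟸ Kriz–Li 2019 Cor. 10.7 (tree fact) + modularity + a CLASS-NUMBER supply «CN-3″(d)»

Seat `bsd-line-cmk2-p1` g23 (cell `bsd-print-cf2`), `--supports stmt-BirchSwinnertonDyer-28663` (helper; closes nothing).
THEOREMS ONLY (no definition, no named fact, no `sorry`).  BSD is NOT proved by this; HL′ is NOT proved by this.

The pen's HL′ memo (HOME `cmk-rev20/HLPRIME-ATTACK-MEMO-g23.md` rev 8, §6/§8b) ranks engine E1 = «Kriz–Li at the Eisenstein prime 3 +
a class-number crux CN-3″» first.  On the sub-slice of H₂ where Kriz–Li's OWN Corollary 10.7 (2) applies — the sextic twists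
`E_d : y² = x³ − 432d` with `d` a NEGATIVE fundamental discriminant, `d ≡ 2 (mod 9)`, `h₃(d) = 1` — no Heegner-log bookkeeping is
needed: the tree fact `KrizLi2019.cor107_analyticRank_sexticTwist` gives, for EVERY imaginary quadratic `K` with the Heegner
hypothesis for `3|d|` and `h₃(−3·d_K·d) = 1`, `r_an(E_d) = 1` and `r_an(E_d^{(d_K)}) = 0`, i.e. `L(E_d^{(d_K)}, 1) ≠ 0`
(`analyticRank_eq_zero_iff`, modularity).  Hence HL′ for such `W` follows from the purely arithmetic-statistical supply
**CN-3″(W, d)**: «some imaginary quadratic `K` with odd `d_K ≠ −3`, the Heegner hypothesis for `N_W` and for `3|d|`, one-bit genus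
defect `Σ_W(d_K) ≤ 1`, and `3 ∤ h(ℚ(√(−3·d_K·d)))`» — a class-number indivisibility statement on a thin set of discriminants
(nearest prints: Belabas–Fouvry 1999 Cor. 1.9, Wiles 2015, Beckwith 2017 — none controls all prime factors of `d_K`; NOT in print,
pen §8b).  This file is the kernel form of that reduction, per curve:

* `silentHeegnerTwin_of_cor107_of_classNumberSupply` — **for `W ≅_ℚ E_d` (`d < 0` fundamental, `d ≡ 2 (mod 9)`, `h₃(d) = 1`):
  cor107 ∧ modularity ∧ CN-3″(W, d) ⟹ the conclusion of HL′ for `W`** (a `K` with odd `d_K ≠ −3`, Heegner for `N_W`, `Σ ≤ 1`,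
  `L(W^{(d_K)},1) ≠ 0`);
* `analyticRank_eq_one_of_cor107_of_classNumberSupply` — on the same data `r_an(W) = 1` comes for free (the slice lies in the
  `r_an = 1` part of the sextic family, as HL′'s own binder demands).

References: [KrizLi2019] Cor. 10.7 (with Thm. 10.6, §10.2), Thm. 9.4; [BCDTJAMS2001] Thm. A; [BirchSwinnertonDyer1965].
-/

set_option autoImplicit false
-- the Theorems namespace of this sub repeats the summit name by design (D-0017 nested layout)
set_option linter.dupNamespace false

noncomputable section

open scoped Classical

open WeierstrassCurve NumberField Literature.NumberTheory.EllipticCurves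
  Literature.NumberTheory.EllipticCurves.ModularForms
  Literature.NumberTheory.EllipticCurves.KrizLi2019

namespace Summit.BirchSwinnertonDyer.BirchSwinnertonDyer.Theorems.SilentSupplyTwo

/-- **The Kriz–Li sextic door for HL′, per curve.**  Let `W/ℚ` be any model of `E_d : y² = x³ − 432d` with `d < 0` a fundamental
discriminant, `d ≡ 2 (mod 9)` and `h₃(d) = 1` (`ThreeClassNumberTrivial d`).  Granted Kriz–Li 2019 Cor. 10.7 (tree fact
`cor107_analyticRank_sexticTwist`) and modularity (`hasEntireLFunction_rat`), the class-number supply CN-3″(W, d) — an imaginary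
quadratic `K` with odd `d_K ≠ −3`, the Heegner hypothesis for `N_W` and for `3|d|`, `Σ_W(d_K) ≤ 1` and `h₃(−3·d_K·d) = 1` — yields
the conclusion of `CMSilentHeegnerTwinSupplyAtInertTwo` for `W`: that same `K` has `L(W^{(d_K)}, 1) ≠ 0` (Cor. 10.7 (2):
`r_an(E_d^{(d_K)}) = 0`).  Conditional on the print and the supply; closes nothing.
[cite: KrizLi2019, Cor. 10.7 (2) with Thm. 10.6] [cite: BCDTJAMS2001, Thm. A] [cite: BirchSwinnertonDyer1965] -/
theorem silentHeegnerTwin_of_cor107_of_classNumberSupply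
    (h107 : cor107_analyticRank_sexticTwist) (hmod : hasEntireLFunction_rat)
    (W : WeierstrassCurve ℚ) [W.IsElliptic] [W.IsGloballyMinimal] [NeZero (W.conductorNorm ℤ)] (d : ℤ)
    (hW : ∃ C : VariableChange ℚ, C • W = ({ a₁ := 0, a₂ := 0, a₃ := 0, a₄ := 0, a₆ := -432 * d } : WeierstrassCurve ℚ))
    (hd : d < 0) (hd9 : d % 9 = 2)
    (h1 : (d % 4 = 1 ∧ Squarefree d ∧ d ≠ 1) ∨ (4 ∣ d ∧ (d / 4 % 4 = 2 ∨ d / 4 % 4 = 3) ∧ Squarefree (d / 4)))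
    (h3d : ThreeClassNumberTrivial d)
    (hsup : ∃ (K : Type) (_ : Field K) (_ : NumberField K), IsImaginaryQuadratic K ∧ Odd (NumberField.discr K) ∧
      NumberField.discr K ≠ -3 ∧ SatisfiesHeegnerHypothesis (W.conductorNorm ℤ) K ∧ SatisfiesHeegnerHypothesis (3 * d.natAbs) K ∧
      (∑ q ∈ (NumberField.discr K).natAbs.primeFactors, ((if jacobiSym W.Δ.num q = -1 then 1 else 0) +
        (if jacobiSym W.Δ.num q = 1 ∧ Even (W.frobeniusTrace q) then 2 else 0)) ≤ 1) ∧
      ThreeClassNumberTrivial (-3 * NumberField.discr K * d)) :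
    ∃ (K : Type) (_ : Field K) (_ : NumberField K), IsImaginaryQuadratic K ∧ Odd (NumberField.discr K) ∧
      NumberField.discr K ≠ -3 ∧ SatisfiesHeegnerHypothesis (W.conductorNorm ℤ) K ∧
      (∑ q ∈ (NumberField.discr K).natAbs.primeFactors, ((if jacobiSym W.Δ.num q = -1 then 1 else 0) +
        (if jacobiSym W.Δ.num q = 1 ∧ Even (W.frobeniusTrace q) then 2 else 0)) ≤ 1) ∧
      (W.quadraticTwist (NumberField.discr K : ℚ)).entireLFunction 1 ≠ 0 := by
  obtain ⟨K, _, _, hK, hodd, h3, hHN, hH3d, hsig, hCN⟩ := hsup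
  have h2 : d % 3 = 2 ∨ d % 9 = 3 := Or.inl (by omega)
  have h3pos : 0 < d → ThreeClassNumberTrivial (-3 * d) ∧ ThreeClassNumberTrivial (NumberField.discr K * d) :=
    fun h ↦ absurd h (not_lt.mpr hd.le)
  have h3neg : d < 0 → ThreeClassNumberTrivial d ∧ ThreeClassNumberTrivial (-3 * NumberField.discr K * d) :=
    fun _ ↦ ⟨h3d, hCN⟩
  obtain ⟨-, hr0⟩ := (h107 d W K hW hK hH3d h1 h2 h3pos h3neg).2 (Or.inl ⟨hd, hd9⟩)
  have hD0 : (NumberField.discr K : ℚ) ≠ 0 := by exact_mod_cast NumberField.discr_ne_zero K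
  haveI := W.isElliptic_quadraticTwist hD0
  have hL : (W.quadraticTwist (NumberField.discr K : ℚ)).entireLFunction 1 ≠ 0 :=
    ((W.quadraticTwist (NumberField.discr K : ℚ)).analyticRank_eq_zero_iff_holds (hmod _)).mp hr0
  exact ⟨K, _, _, hK, hodd, h3, hHN, hsig, hL⟩

/-- **On the same slice `r_an(W) = 1` is part of the print** (Cor. 10.7 (2), `d < 0`, `d ≡ 2 (mod 9)`): the Kriz–Li sextic door lies
inside HL′'s own habitat binder `W.analyticRank = 1`.  Conditional on the print and on ONE field `K` with the Heegner hypothesis for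
`3|d|` and `h₃(−3·d_K·d) = 1` (Kriz–Li Thm. 9.4 supplies such `K` in positive proportion — tree fact
`thm94_exists_heegnerField_h3_eq_one` —, but that is not needed here). [cite: KrizLi2019, Cor. 10.7 (2), Thm. 9.4] -/
theorem analyticRank_eq_one_of_cor107_of_classNumberSupply
    (h107 : cor107_analyticRank_sexticTwist) (W : WeierstrassCurve ℚ) [W.IsElliptic] (d : ℤ)
    (hW : ∃ C : VariableChange ℚ, C • W = ({ a₁ := 0, a₂ := 0, a₃ := 0, a₄ := 0, a₆ := -432 * d } : WeierstrassCurve ℚ))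
    (hd : d < 0) (hd9 : d % 9 = 2)
    (h1 : (d % 4 = 1 ∧ Squarefree d ∧ d ≠ 1) ∨ (4 ∣ d ∧ (d / 4 % 4 = 2 ∨ d / 4 % 4 = 3) ∧ Squarefree (d / 4)))
    (h3d : ThreeClassNumberTrivial d)
    {K : Type} [Field K] [NumberField K] (hK : IsImaginaryQuadratic K) (hH3d : SatisfiesHeegnerHypothesis (3 * d.natAbs) K)
    (hCN : ThreeClassNumberTrivial (-3 * NumberField.discr K * d)) :
    W.analyticRank = 1 :=
  analyticRank_eq_one_of_cor107 h107 d W K hW hK hH3d h1 (Or.inl (by omega))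
    (fun h ↦ absurd h (not_lt.mpr hd.le)) (fun _ ↦ ⟨h3d, hCN⟩) (Or.inl ⟨hd, hd9⟩)

end Summit.BirchSwinnertonDyer.BirchSwinnertonDyer.Theorems.SilentSupplyTwo

end
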